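import Mathlib
import HarnessLib
import Summits.HubbardSuperconductivity.HubbardSuperconductivity.Theses.KLProgramme
import Summits.HubbardSuperconductivity.HubbardSuperconductivity.Theorems.KLProgrammeKLRegimeVolumeLimitExDefs
import Summits.HubbardSuperconductivity.HubbardSuperconductivity.Theorems.KLProgrammeKLRegimeSplitBundleV16

/-!
# Route `KLProgramme` — crux K3 gen 6, child `KLRegimeTwoPointAssemblyV16 := TwoPointAssemblyP3 klPredsV16 FinalTwoLegVolLimitEx klWindowC`, CLOSED by
# the universal ∃-threshold assembly `KLRegimeSplit.twoPointAssemblyP3_ex` (Pr-universal, p475968).  Proof only; nothing here asserts superconductivity.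
-/

noncomputable section

namespace Summit.HubbardSuperconductivity.HubbardSuperconductivity.Theorems.TwoPointAssembly

set_option linter.dupNamespace false -- summit = problem name (single-conjunct summit), D-0017

/-- **Gen-6 child TwoPointAssembly of K3 holds**, by the universal ∃-threshold assembly `KLRegimeSplit.twoPointAssemblyP3_ex`. -/
theorem KLRegimeTwoPointAssemblyV16_of :
    Summit.HubbardSuperconductivity.HubbardSuperconductivity.Theses.KLProgramme.KLRegimeTwoPointAssemblyV16 :=
  KLRegimeSplit.twoPointAssemblyP3_ex _ _

end Summit.HubbardSuperconductivity.HubbardSuperconductivity.Theorems.TwoPointAssembly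

end
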